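import Mathlib
import Summits.KontsevichZagierPeriods.Zeta5Search.Families.BasicMonotone
import HarnessLib

/-!
# ζ(5) search — Families: `f_σ < 1` for convergent seatings; the basic cellular integrals decrease STRICTLY to `0`

HONEST FRAMING: systematic search; no irrationality claim unless certified.  STRUCTURAL facts about the convergence side
of Brown's basic cellular integrals `I_σ(N) = ∫_{S_n} f_σ^N ω_σ` [Brown2016, §1.5 (1.3)–(1.4)]; nothing about the
arithmetic of any zeta value, no asymptotic rate.

`Families/BasicMonotone.lean` proved `0 < f_σ ≤ 1` on the open simplex for every bijective seating `σ` (Hall matching of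
the finite `σδ⁰`-edges to gaps) and `I_σ(N+1) ≤ I_σ(N)`.  Here, for a CONVERGENT seating on `n = ℓ + 3 ≥ 4` points:
* `exists_sEdge_two_le_card_span` — some finite `σδ⁰`-edge spans at least two gaps (adjacent guests never sit together:
  the window `{i, i+1}` must not be seated into a block — Brown's condition with `k = 2`);
* `fSigma_lt_one` — hence `f_σ < 1` STRICTLY at every interior point (the matched product inequality is strict in that
  factor);
* `basic_succ_lt`, `integral_basic_succ_lt`, `integral_basic_strictAnti` — `I_σ(N+1) < I_σ(N)`;
* `tendsto_integral_basic_zero` — `I_σ(N) → 0` as `N → ∞` for EVERY bijective seating on `n ≥ 4` points (dominated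
  convergence with the integrable majorant `f_σ^0 ω_σ` when `σ` is convergent; the junk value `0` otherwise);
* `volume_openSimplex_ne_zero` — the open simplex has positive volume (extracted from `IntegrabilityCriterion`).
Standard axioms only.
-/

noncomputable section

open MeasureTheory Set Finset Filter Topology

namespace Summit.KontsevichZagierPeriods.Zeta5Search.Families.Cellular

variable {ℓ : ℕ} (σ : Fin (ℓ + 3) → Fin (ℓ + 3))

/-! ### The open simplex has positive volume -/

/-- The open simplex `0 < t₁ < ⋯ < t_ℓ < 1` has non-zero Lebesgue measure (it is the measure-preserving image of the gap
set, which contains the box `(0, 1/(ℓ+1))^ℓ`). -/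
theorem volume_openSimplex_ne_zero (ℓ : ℕ) : volume (openSimplex ℓ) ≠ 0 := by
  intro h0
  have h1 : ∫⁻ _t in openSimplex ℓ, (1 : ENNReal) = 0 := by rw [setLIntegral_const, h0, mul_zero]
  rw [lintegral_openSimplex_eq_gapSet (fun _ => (1 : ENNReal)) measurable_const, setLIntegral_const, one_mul] at h1
  have hsub : Set.pi univ (fun _ : Fin ℓ => Ioo (0 : ℝ) (1 / (ℓ + 1))) ⊆ gapSet ℓ := by
    intro h hh'
    simp only [Set.mem_pi, Set.mem_univ, Set.mem_Ioo, forall_true_left] at hh'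
    refine ⟨fun j => (hh' j).1, ?_⟩
    calc ∑ j, h j ≤ ∑ _j : Fin ℓ, (1 / (ℓ + 1 : ℝ)) := Finset.sum_le_sum fun j _ => (hh' j).2.le
      _ = ℓ * (1 / (ℓ + 1 : ℝ)) := by simp
      _ < 1 := by
          rw [mul_one_div, div_lt_one (by positivity)]
          linarith
  have hvol : volume (Set.pi univ (fun _ : Fin ℓ => Ioo (0 : ℝ) (1 / (ℓ + 1)))) ≠ 0 := by
    rw [volume_pi_pi]
    refine Finset.prod_ne_zero_iff.2 fun j _ => ?_
    rw [Real.volume_Ioo, Ne, ENNReal.ofReal_eq_zero, not_le]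
    have : (0 : ℝ) < 1 / (ℓ + 1) := by positivity
    linarith
  exact hvol (measure_mono_null hsub h1)

/-! ### Convergent seatings have a long finite edge -/

/-- For a convergent bijective seating on `n = ℓ + 3 ≥ 4` points, some finite `σδ⁰`-edge `{z_{σ_i}, z_{σ_{i+1}}}` spans
at least two gaps: otherwise the window `{i, i+1}` would be seated into the block `{σ_i, σ_i ± 1}`, against Brown's
condition with `k = 2`. [Brown2016, §1.5] -/
theorem exists_sEdge_two_le_card_span (hσ : Function.Bijective σ) (hc : Convergent σ) (hℓ : 1 ≤ ℓ) :
    ∃ i : SEdge σ, 2 ≤ ((cellEdges σ hσ.1).span (Sum.inr i)).card := by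
  classical
  -- the position right after the guest `∞`: both `σ (j+1)` and `σ (j+2)` are finite
  obtain ⟨j, hj⟩ := hσ.2 (Fin.last (ℓ + 2))
  have hfin : ∀ x : Fin (ℓ + 3), x ≠ j → (σ x).val ≠ ℓ + 2 := by
    intro x hx h
    apply hx
    apply hσ.1
    rw [hj]
    exact Fin.ext (by rw [h, Fin.val_last])
  have h1 : j + 1 ≠ j := fun h => succ_ne_self j h.symm
  have h2 : j + 1 + 1 ≠ j := by
    intro h
    have h' := congrArg (fun x : Fin (ℓ + 3) => x - j) h
    simp only [add_assoc, add_sub_cancel_left, sub_self] at h'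
    have h'' := congrArg Fin.val h'
    rw [Fin.val_add, Fin.val_zero, Fin.val_one', Nat.mod_eq_of_lt (show 1 < ℓ + 3 by omega),
      Nat.mod_eq_of_lt (show 1 + 1 < ℓ + 3 by omega)] at h''
    omega
  let i0 : SEdge σ := ⟨j + 1, hfin _ h1, hfin _ h2⟩
  refine ⟨i0, ?_⟩
  by_contra hlt
  rw [not_le] at hlt
  -- the span `{lo ≤ w < hi}` has fewer than two elements, so `hi = lo + 1`
  set E := cellEdges σ hσ.1 with hE
  have hlo : E.lo (Sum.inr i0) = min (σ (j + 1)).val (σ (j + 1 + 1)).val := rfl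
  have hhi : E.hi (Sum.inr i0) = max (σ (j + 1)).val (σ (j + 1 + 1)).val := rfl
  have hlh := E.lo_lt_hi (Sum.inr i0)
  have hhi' := E.hi_le (Sum.inr i0)
  have hsucc : E.hi (Sum.inr i0) = E.lo (Sum.inr i0) + 1 := by
    by_contra hne
    have htwo : E.lo (Sum.inr i0) + 2 ≤ E.hi (Sum.inr i0) := by omega
    apply (lt_irrefl 1 : ¬ (1 : ℕ) < 1)
    calc (1 : ℕ) < (E.span (Sum.inr i0)).card := by
          rw [Finset.one_lt_card_iff]
          refine ⟨⟨E.lo (Sum.inr i0), by omega⟩, ⟨E.lo (Sum.inr i0) + 1, by omega⟩, ?_, ?_, ?_⟩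
          · rw [EdgeFamily.mem_span]; simp only; omega
          · rw [EdgeFamily.mem_span]; simp only; omega
          · intro h; have := congrArg Fin.val h; simp only at this; omega
      _ ≤ 1 := by omega
  -- hence the window `{j+1, j+2}` is seated into a block of two consecutive places
  apply hc (j + 1) 2 (by omega) le_rfl
  -- elements of the arc of length two
  have harc : ∀ v : Fin (ℓ + 3), v ∈ arc (j + 1) 2 → v = j + 1 ∨ v = j + 1 + 1 := by
    intro v hv
    rw [mem_arc] at hv
    rcases Nat.lt_or_ge ((v - (j + 1) : Fin (ℓ + 3)) : ℕ) 1 with h | h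
    · left
      have : (v - (j + 1) : Fin (ℓ + 3)) = 0 := Fin.ext (by rw [Fin.val_zero]; omega)
      rwa [sub_eq_zero] at this
    · right
      have : (v - (j + 1) : Fin (ℓ + 3)) = 1 := Fin.ext (by rw [Fin.val_one]; omega)
      rw [sub_eq_iff_eq_add] at this
      exact this.trans (add_comm _ _)
  -- membership in an arc of length two from a value computation
  have hmem : ∀ a x : Fin (ℓ + 3), (x = a ∨ x.val = a.val + 1) → x ∈ arc a 2 := by
    rintro a x (h | h)
    · rw [mem_arc, h, sub_self, Fin.val_zero]; norm_num
    · rw [mem_arc, Fin.sub_val_of_le (Fin.le_iff_val_le_val.2 (by omega)), h]; norm_num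
  rcases le_total (σ (j + 1)).val (σ (j + 1 + 1)).val with hle | hle
  · rw [min_eq_left hle] at hlo
    rw [max_eq_right hle] at hhi
    refine ⟨σ (j + 1), fun v hv => ?_⟩
    rcases harc v hv with h | h
    · exact hmem _ _ (Or.inl (by rw [h]))
    · exact hmem _ _ (Or.inr (by rw [h]; omega))
  · rw [min_eq_right hle] at hlo
    rw [max_eq_left hle] at hhi
    refine ⟨σ (j + 1 + 1), fun v hv => ?_⟩
    rcases harc v hv with h | h
    · exact hmem _ _ (Or.inr (by rw [h]; omega))
    · exact hmem _ _ (Or.inl (by rw [h]))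

/-! ### `f_σ < 1` strictly -/

/-- The finite `σδ⁰`-edges are `ℓ + 1` in number (all positions except the two around the guest `∞`). -/
theorem card_sEdge (hσ : Function.Bijective σ) : Fintype.card (SEdge σ) = ℓ + 1 := by
  classical
  obtain ⟨m, hm, -⟩ := exists_gap_matching σ hσ
  apply le_antisymm
  · simpa using Fintype.card_le_of_injective m hm
  obtain ⟨j, hj⟩ := hσ.2 (Fin.last (ℓ + 2))
  have hsub : (univ.filter fun i : Fin (ℓ + 3) => ¬ ((σ i).val ≠ ℓ + 2 ∧ (σ (i + 1)).val ≠ ℓ + 2)) ⊆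
      {j, j - 1} := by
    intro i hi
    simp only [Finset.mem_filter, Finset.mem_univ, true_and, not_and_or, not_not] at hi
    rw [Finset.mem_insert, Finset.mem_singleton]
    rcases hi with h | h
    · left; apply hσ.1; rw [hj]; exact Fin.ext (by rw [h, Fin.val_last])
    · right
      have : i + 1 = j := by apply hσ.1; rw [hj]; exact Fin.ext (by rw [h, Fin.val_last])
      rw [← this, add_sub_cancel_right]
  have h2 : (univ.filter fun i : Fin (ℓ + 3) => ¬ ((σ i).val ≠ ℓ + 2 ∧ (σ (i + 1)).val ≠ ℓ + 2)).card ≤ 2 :=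
    (Finset.card_le_card hsub).trans (Finset.card_insert_le _ _)
  have hsum := Finset.card_filter_add_card_filter_not
    (s := (Finset.univ : Finset (Fin (ℓ + 3)))) (fun i : Fin (ℓ + 3) => (σ i).val ≠ ℓ + 2 ∧ (σ (i + 1)).val ≠ ℓ + 2)
  rw [Finset.card_univ, Fintype.card_fin] at hsum
  rw [Fintype.card_subtype]
  omega

/-- A gap matching is a BIJECTION between the finite `σδ⁰`-edges and the `ℓ + 1` gaps. -/
theorem exists_gap_equiv (hσ : Function.Bijective σ) :
    ∃ e : SEdge σ ≃ Fin (ℓ + 1), ∀ i, e i ∈ (cellEdges σ hσ.1).span (Sum.inr i) := by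
  classical
  obtain ⟨m, hm, hspan⟩ := exists_gap_matching σ hσ
  have hbij : Function.Bijective m :=
    (Fintype.bijective_iff_injective_and_card m).2 ⟨hm, by rw [card_sEdge σ hσ, Fintype.card_fin]⟩
  exact ⟨Equiv.ofBijective m hbij, fun i => hspan i⟩

/-- **`f_σ < 1` strictly on the open simplex for a convergent seating** (`n ≥ 4`): in the matched comparison
`∏_w gap_w ≤ ∏_i len_i` the long edge of `exists_sEdge_two_le_card_span` gives a strict factor. -/
theorem fSigma_lt_one (hσ : Function.Bijective σ) (hc : Convergent σ) (hℓ : 1 ≤ ℓ) {t : Fin ℓ → ℝ}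
    (ht : t ∈ openSimplex ℓ) : fSigma σ t < 1 := by
  classical
  obtain ⟨e, hspan⟩ := exists_gap_equiv σ hσ
  obtain ⟨i1, hi1⟩ := exists_sEdge_two_le_card_span σ hσ hc hℓ
  have hpos := (mem_openSimplex_iff_gapN t).1 ht
  have hden : 0 < formDen σ t := Finset.prod_pos fun i _ => ef_pos ht fun h => succ_ne_self i (hσ.1 h)
  unfold fSigma
  rw [div_lt_one hden, prod_ef_succ_eq_prod_gapN, formDen_eq_prod_len σ hσ ht, ← Equiv.prod_comp e]
  have hle : ∀ i : SEdge σ, gapN t (e i) ≤ (cellEdges σ hσ.1).len t (Sum.inr i) := by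
    intro i
    rw [(cellEdges σ hσ.1).len_eq_sum_gap]
    exact Finset.single_le_sum (fun w _ => (hpos w).le) (hspan i)
  refine Finset.prod_lt_prod (fun i _ => hpos _) (fun i _ => hle i) ⟨i1, Finset.mem_univ _, ?_⟩
  -- the long edge: a second gap `w ≠ e i1` inside its span
  obtain ⟨w, hw, hwne⟩ := Finset.exists_mem_ne hi1 (e i1)
  rw [(cellEdges σ hσ.1).len_eq_sum_gap]
  exact Finset.single_lt_sum hwne (hspan i1) hw (hpos w) fun k _ _ => (hpos k).le

/-! ### Strict decrease and the limit `0` -/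

/-- `f_σ^{N+1} ω_σ = f_σ · f_σ^N ω_σ` pointwise on the open simplex. -/
theorem basic_succ_eq (hσi : Function.Injective σ) (N : ℤ) {t : Fin ℓ → ℝ} (ht : t ∈ openSimplex ℓ) :
    basic σ (N + 1) t = basic σ N t * fSigma σ t := by
  have hf := fSigma_pos σ hσi ht
  rw [basic_eq, basic_eq]
  change fSigma σ t ^ (N + 1) / formDen σ t = fSigma σ t ^ N / formDen σ t * fSigma σ t
  rw [zpow_add_one₀ hf.ne']
  ring

/-- For a convergent seating the basic integrands decrease STRICTLY with the exponent at every interior point. -/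
theorem basic_succ_lt (hσ : Function.Bijective σ) (hc : Convergent σ) (hℓ : 1 ≤ ℓ) (N : ℤ) {t : Fin ℓ → ℝ}
    (ht : t ∈ openSimplex ℓ) : basic σ (N + 1) t < basic σ N t := by
  rw [basic_succ_eq σ hσ.1 N ht]
  exact mul_lt_of_lt_one_right (integrand_pos hσ.1 _ _ ht) (fSigma_lt_one σ hσ hc hℓ ht)

/-- `f_σ^N ω_σ ≤ f_σ^0 ω_σ = ω_σ` for `N ∈ ℕ` (the dominating function). -/
theorem basic_le_basic_zero (hσ : Function.Bijective σ) (N : ℕ) {t : Fin ℓ → ℝ} (ht : t ∈ openSimplex ℓ) :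
    basic σ (N : ℤ) t ≤ basic σ 0 t := by
  induction N with
  | zero => simp
  | succ N ih =>
    have h := basic_succ_le σ hσ (N : ℤ) ht
    rw [Nat.cast_succ]
    exact h.trans ih

/-- Pointwise limit: `f_σ(t)^N ω_σ(t) → 0` for a convergent seating (`f_σ(t) < 1`). -/
theorem tendsto_basic_zero (hσ : Function.Bijective σ) (hc : Convergent σ) (hℓ : 1 ≤ ℓ) {t : Fin ℓ → ℝ}
    (ht : t ∈ openSimplex ℓ) : Tendsto (fun N : ℕ => basic σ (N : ℤ) t) atTop (𝓝 0) := by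
  have h : (fun N : ℕ => basic σ (N : ℤ) t) = fun N : ℕ => fSigma σ t ^ N / formDen σ t := by
    funext N
    rw [basic_eq, zpow_natCast]
    rfl
  rw [h]
  simpa using (tendsto_pow_atTop_nhds_zero_of_lt_one (fSigma_pos σ hσ.1 ht).le
    (fSigma_lt_one σ hσ hc hℓ ht)).div_const (formDen σ t)

/-- **`I_σ(N+1) < I_σ(N)`** for a convergent seating on `n ≥ 4` points. -/
theorem integral_basic_succ_lt (hσ : Function.Bijective σ) (hc : Convergent σ) (hℓ : 1 ≤ ℓ) (N : ℕ) :
    integral σ (fun _ => ((N : ℤ) + 1)) (fun _ => ((N : ℤ) + 1)) < integral σ (fun _ => (N : ℤ)) (fun _ => (N : ℤ)) := by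
  have h0 : Integrable (integrand σ (fun _ => (N : ℤ)) (fun _ => (N : ℤ))) (volume.restrict (openSimplex ℓ)) :=
    integrableOn_basic_of_convergent σ hσ hc (Int.natCast_nonneg N)
  have h1 : Integrable (integrand σ (fun _ => (N : ℤ) + 1) (fun _ => (N : ℤ) + 1)) (volume.restrict (openSimplex ℓ)) :=
    integrableOn_basic_of_convergent σ hσ hc (by positivity)
  have hpt : ∀ t ∈ openSimplex ℓ, 0 < integrand σ (fun _ => (N : ℤ)) (fun _ => (N : ℤ)) t -
      integrand σ (fun _ => (N : ℤ) + 1) (fun _ => (N : ℤ) + 1) t :=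
    fun t ht => sub_pos.2 (basic_succ_lt σ hσ hc hℓ (N : ℤ) ht)
  rw [← sub_pos]
  unfold integral
  rw [← integral_sub h0 h1]
  have hnn : 0 ≤ᵐ[volume.restrict (openSimplex ℓ)] fun t => integrand σ (fun _ => (N : ℤ)) (fun _ => (N : ℤ)) t -
      integrand σ (fun _ => (N : ℤ) + 1) (fun _ => (N : ℤ) + 1) t :=
    (ae_restrict_iff' (measurableSet_openSimplex ℓ)).2 (ae_of_all _ fun t ht => (hpt t ht).le)
  rw [setIntegral_pos_iff_support_of_nonneg_ae hnn (h0.sub h1)]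
  have : Function.support (fun t => integrand σ (fun _ => (N : ℤ)) (fun _ => (N : ℤ)) t -
      integrand σ (fun _ => (N : ℤ) + 1) (fun _ => (N : ℤ) + 1) t) ∩ openSimplex ℓ = openSimplex ℓ := by
    ext t
    simp only [mem_inter_iff, Function.mem_support, and_iff_right_iff_imp]
    exact fun ht => (hpt t ht).ne'
  rw [this]
  exact pos_iff_ne_zero.2 (volume_openSimplex_ne_zero ℓ)

/-- The sequence `N ↦ I_σ(N)` is strictly antitone on `ℕ` for a convergent seating (`n ≥ 4`). -/
theorem integral_basic_strictAnti (hσ : Function.Bijective σ) (hc : Convergent σ) (hℓ : 1 ≤ ℓ) :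
    StrictAnti fun N : ℕ => integral σ (fun _ => (N : ℤ)) (fun _ => (N : ℤ)) :=
  strictAnti_nat_of_succ_lt fun N => by
    have := integral_basic_succ_lt σ hσ hc hℓ N
    simpa [Nat.cast_succ] using this

/-- **`I_σ(N) → 0` as `N → ∞`**, for every bijective seating on `n = ℓ + 3 ≥ 4` points: by dominated convergence
(`0 < f_σ^N ω_σ ≤ ω_σ`, integrable iff `σ` is convergent, and `f_σ < 1` pointwise) when `σ` is convergent; all terms
are the junk value `0` otherwise. [Brown2016, §1.5 objects; structural] -/
theorem tendsto_integral_basic_zero (hσ : Function.Bijective σ) (hℓ : 1 ≤ ℓ) :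
    Tendsto (fun N : ℕ => integral σ (fun _ => (N : ℤ)) (fun _ => (N : ℤ))) atTop (𝓝 0) := by
  by_cases hc : Convergent σ
  · have hF : ∀ N : ℕ, Integrable (integrand σ (fun _ => (N : ℤ)) (fun _ => (N : ℤ)))
        (volume.restrict (openSimplex ℓ)) :=
      fun N => integrableOn_basic_of_convergent σ hσ hc (Int.natCast_nonneg N)
    have hB : Integrable (basic σ 0) (volume.restrict (openSimplex ℓ)) :=
      integrableOn_basic_of_convergent σ hσ hc le_rfl
    have h := tendsto_integral_of_dominated_convergence (μ := volume.restrict (openSimplex ℓ))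
      (F := fun (N : ℕ) t => integrand σ (fun _ => (N : ℤ)) (fun _ => (N : ℤ)) t) (f := fun _ => (0 : ℝ))
      (basic σ 0) (fun N => (hF N).aestronglyMeasurable) hB ?_ ?_
    · have h' : Tendsto (fun N : ℕ => ∫ t in openSimplex ℓ, integrand σ (fun _ => (N : ℤ)) (fun _ => (N : ℤ)) t)
          atTop (𝓝 0) := by simpa using h
      unfold integral
      exact h'
    · intro N
      refine (ae_restrict_iff' (measurableSet_openSimplex ℓ)).2 (ae_of_all _ fun t ht => ?_)
      rw [Real.norm_eq_abs, abs_of_pos (integrand_pos hσ.1 _ _ ht)]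
      exact basic_le_basic_zero σ hσ N ht
    · refine (ae_restrict_iff' (measurableSet_openSimplex ℓ)).2 (ae_of_all _ fun t ht => ?_)
      exact tendsto_basic_zero σ hσ hc hℓ ht
  · have h : (fun N : ℕ => integral σ (fun _ => (N : ℤ)) (fun _ => (N : ℤ))) = fun _ => 0 := by
      funext N
      have h0 : ¬ IntegrableOn (basic σ (N : ℤ)) (openSimplex ℓ) :=
        fun h => hc ((integrableOn_basic_iff_convergent σ hσ (Int.natCast_nonneg N)).1 h)
      have h0' : ¬ Integrable (integrand σ (fun _ => (N : ℤ)) (fun _ => (N : ℤ))) (volume.restrict (openSimplex ℓ)) := h0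
      unfold integral
      exact integral_undef h0'
    rw [h]
    exact tendsto_const_nhds

end Summit.KontsevichZagierPeriods.Zeta5Search.Families.Cellular
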